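import Summits.Ventures.HSemireg.UntwistGerbePullback
import HarnessLib

/-!
# Venture HSemireg — route R1.0 (i), `π^*` half: the LEFT adjoint `π_* ⊣ π^*` DERIVED from the weight
# decomposition `𝓕 = 𝓕₀ ⊕ 𝓕₁` on the `μ₂`-gerbe, and the resulting `Ext` comparison / kernel clause

HONEST FRAMING. Elementary category theory (an adjunction built with `Adjunction.mkOfHomEquiv` from a fully
faithful functor and a natural family of retracts) feeding the block-inclusion comparison of
`UntwistGerbePullback.lean`. No gerbe, no band, no inertia action is constructed: the splitting
`𝓕 = 𝓕₀ ⊕ 𝓕₁` of a sheaf on the gerbe into its `μ₂`-eigensheaves enters as DATA `(ι, p)` with two equations;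
what this file turns into a theorem is the passage «splitting ⟹ `π_*` is LEFT adjoint to `π^*` ⟹ `π^*`
preserves injectives ⟹ `Ext_{𝔊₀}(π^*A, π^*B) = Ext_{X₀}(A, B)`». Nothing here says HC, HC_CM or HC_AV is
proved.

## The step being served (cell pub-hsemireg, `general-structure/PERRY-SUBSTITUTE-GS.md` §1 (R1.0 (i));
## gs-red RED-GS.md GS-23(a) «`π` cohomologically affine, `π_*π^* = id` on weight 0»)

`UntwistGerbePullback.lean` proves the `Ext` comparison for a block inclusion `F` (intended `π^*`) under the
hypothesis «`F` is a right adjoint, `G ⊣ F`, of a monomorphism-preserving `G`» and explains in words why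
`G = π_*` qualifies. Here that hypothesis is DISCHARGED from data of the printed shape [Lieblich2007, arXiv
Lemma 2.1.1.12: for a sheaf with trivial inertia action `π^*π_*F → F` is an isomorphism; Prop. 2.2.1.6: on a
gerbe banded by a diagonalizable group every quasi-coherent sheaf is the direct sum of its eigensheaves,
`⊕_χ 𝓕_χ ⥲ 𝓕`; held text arXiv:math/0411337 p.7 L125–134, p.10 L48–62 — PRINTED FOR QUASI-COHERENT sheaves;
reading it for all `𝒪_{𝔊₀}`-modules is a seat derivation (étale-locally `[U/μ₂]`, idempotents `(1 ± ι)/2`,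
`2 ∈ 𝒪^×`), and both the splitting and `Hom(𝓕₁, π^*E) = 0` are the TAME input (`μ₂` linearly reductive; here
over `ℂ`) — nothing is claimed for wild gerbes; ref-2 (P1), gs-lead / th-1]:

* `F : C ⥤ D` fully faithful (intended `π^* : Mod(𝒪_{X₀}) → Mod(𝒪_{𝔊₀})`), `R : D ⥤ C` ANY functor
  (intended `π_*`);
* `ι_Y : F(R Y) ⟶ Y`, natural in `Y` (intended: the counit `π^*π_*𝓕 → 𝓕`, an isomorphism onto the
  weight-`0` eigensheaf `𝓕₀`);
* `p_Y : Y ⟶ F(R Y)` with `ι_Y ≫ p_Y = 𝟙` (intended: the projection `𝓕 ↠ 𝓕₀` along `𝓕₁`);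
* `p_Y ≫ ι_Y ≫ h = h` for every `h : Y ⟶ F X` (intended: a morphism `𝓕 → π^*E` kills `𝓕₁` —
  `Hom(𝓕₁, π^*E) = 0` because morphisms of `𝒪_𝔊`-modules commute with the inertia action and
  `(π^*E)₁ = 0`).

## What is PROVED here (0 sorry, 0 named facts, no definitions)

* `nonempty_adjunction_of_weightDecomposition` — from the four items: an adjunction `R ⊣ F` EXISTS
  (hom-equivalence `(R Y ⟶ X) ≃ (Y ⟶ F X)`, `g ↦ p_Y ≫ F g`, `h ↦ F⁻¹(ι_Y ≫ h)`). No adjunction `F ⊣ R` and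
  no exactness of `R` is used. NOTE (ref-2 (P3)): `p` is NOT assumed natural in `Y` — only `ι` is; the unit of
  the adjunction so obtained is `p`, and its naturality FOLLOWS (it is the inverse bijection of a natural one),
  so no hypothesis is missing.
* `preservesInjectiveObjects_of_weightDecomposition` — if moreover `R` preserves monomorphisms (automatic for
  a right adjoint; `π_*` is one) then `F` preserves injective objects.
* `mapExtAddHom_bijective_of_weightDecomposition` — abelian setting, `F` additive exact fully faithful with its
  STANDARD right adjoint `adj : F ⊣ R` (intended `π^* ⊣ π_*`), `ι :=` the counit of `adj`, `p` as above, `C`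
  with enough injectives (for `Mod(𝒪_X)`: tree instance, Hartshorne III.2.2) ⟹ `Extⁿ(X, Y) → Extⁿ(F X, F Y)`
  bijective for all `X Y n`. So the `π^*` half of R1.0 (i) holds with «`π_*π^* = id` on weight `0` /
  `𝓕 = 𝓕₀ ⊕ 𝓕₁`» as its ONLY input beyond the standard adjunction — the exactness of `π_*` is not invoked
  SEPARATELY; the weight splitting `(ι, p)` is itself the characteristic-`0` / linearly-reductive (tame) input
  [AbramovichOlssonVistoli2008, Thm. 3.2] (red-4 R4-13b).
* `mapExtAddHom_comp_equivalence_bijective_of_weightDecomposition` — composed with an equivalence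
  `Φ : D ≌ D′` (intended `- ⊗ L^{∓1}`): the map of R1.0 shape `θ(ξ) = π^*ξ ⊗ 1` on `Ext²(E, E)` for a SHEAF `E`
  is bijective. REACH (ref-2 (P2)): every theorem here takes objects of an abelian category; the route's object
  `E₀` is a two-term perfect complex (`Ext²_{X₀}(E₀, E₀) = Hom_{D(X₀)}(E₀, E₀[2])`, dimension `18`), for which
  the analogous `θ` is the DERIVED comparison (`Rπ_*π^* = id` + projection formula, printed) and is NOT supplied
  here; for `E₀` only `UntwistFullSigma.jointlyInjective_iff_of_triangular` applies, with `θ`-bijectivity as a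
  hypothesis.
* `jointlyInjective_iff_of_weightDecomposition_comp_equivalence` — the carrier-free kernel clause with that
  `θ` (triangular re-expansion = the Leibniz rule, a hypothesis as in the other files). The real-carrier forms
  (`σ_q = sigmaHigher hE q`, `E` finite locally free on `X/S`) are those of `UntwistGerbePullback.lean`
  (`isISemiregular_iff_jointlyInjective_of_leftAdjoint_comp_equivalence` and its `univ` / one-sided variants)
  applied to the adjunction obtained from `nonempty_adjunction_of_weightDecomposition`; they are not restated.

## What is NOT proved here

The splitting data `(ι, p)` itself (no band / inertia / eigensheaves in the tree); the twist functor `Φ`; the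
Leibniz rule; anything about the two-term complex `E₀` itself (sheaf carriers only — see REACH above; a `σ_q`
for perfect complexes alone would not suffice, the derived `θ` is also needed). See `UntwistGerbePullback.lean`
for the full dictionary and `UntwistFullSigma.lean`, `UntwistKappaClass.lean`, `UntwistExtEquivalence.lean` for
R1.0 (iii), (ii) and the equivalence half of (i).

## References

* M. Lieblich, *Moduli of twisted sheaves*, Duke Math. J. 138 (2007) 23–118; arXiv:math/0411337, Lemma
  2.1.1.12 and Prop. 2.2.1.6 (arXiv numbering). [Lieblich2007]
* R. Hartshorne, *Algebraic Geometry*, III.2.2. [Hartshorne1977]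
* R.-O. Buchweitz, H. Flenner, Compositio Math. 137 (2003), Def. 4.1, §5. [BuchweitzFlenner2003]
* D. Abramovich, M. Olsson, A. Vistoli, Ann. Inst. Fourier 58 (2008), Def. 3.1, Thm. 3.2 (published
  numbering). [AbramovichOlssonVistoli2008]
-/

open CategoryTheory CategoryTheory.Abelian CategoryTheory.Limits AlgebraicGeometry

namespace Summit.Ventures.HSemireg

/-! ### The left adjoint DERIVED from the weight decomposition `𝓕 = 𝓕₀ ⊕ 𝓕₁` -/

section WeightDecomposition

universe v v' u u'

variable {C : Type u} [Category.{v} C] {D : Type u'} [Category.{v'} D]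
  {F : C ⥤ D} [F.Full] [F.Faithful] {R : D ⥤ C}
  (ι : ∀ Y : D, F.obj (R.obj Y) ⟶ Y) (p : ∀ Y : D, Y ⟶ F.obj (R.obj Y))
  (hι : ∀ ⦃Y Y' : D⦄ (m : Y ⟶ Y'), F.map (R.map m) ≫ ι Y' = ι Y ≫ m)
  (hp : ∀ Y : D, ι Y ≫ p Y = 𝟙 (F.obj (R.obj Y)))
  (hp₀ : ∀ ⦃Y : D⦄ ⦃X : C⦄ (h : Y ⟶ F.obj X), p Y ≫ ι Y ≫ h = h)

include hι hp hp₀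

/-- **Weight decomposition ⟹ the inclusion of the weight-`0` block has a LEFT adjoint.** Let `F : C ⥤ D`
be fully faithful (intended `π^* : Mod(𝒪_{X₀}) → Mod(𝒪_{𝔊₀})`), `R : D ⥤ C` any functor (intended `π_*`),
`ι_Y : F(R Y) ⟶ Y` a natural family (intended: the counit `π^*π_*𝓕 → 𝓕`, an isomorphism onto the
weight-`0` eigensheaf `𝓕₀`), `p_Y : Y ⟶ F(R Y)` with `ι_Y ≫ p_Y = 𝟙` (intended: the projection `𝓕 ↠ 𝓕₀`
along `𝓕₁` given by the splitting `𝓕 = 𝓕₀ ⊕ 𝓕₁` under the central `μ₂`), and suppose every morphism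
`h : Y ⟶ F X` satisfies `p_Y ≫ ι_Y ≫ h = h` (intended: `h` kills `𝓕₁`, i.e. `Hom(𝓕₁, π^*E) = 0` — morphisms of
`𝒪_𝔊`-modules commute with the inertia action and `(π^*E)₁ = 0`). Then `R ⊣ F`: the hom-equivalence
`(R Y ⟶ X) ≃ (Y ⟶ F X)` is `g ↦ p_Y ≫ F g`, `h ↦ F⁻¹(ι_Y ≫ h)`. No adjunction `F ⊣ R` and no exactness of
`R` is used. [cite: Lieblich2007, arXiv Lemma 2.1.1.12 (π^*π_* ⥲ weight 0) and Prop. 2.2.1.6 (⊕_χ 𝓕_χ ⥲ 𝓕)] -/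
theorem nonempty_adjunction_of_weightDecomposition : Nonempty (R ⊣ F) := by
  refine ⟨Adjunction.mkOfHomEquiv
    { homEquiv := fun Y X =>
        { toFun := fun g => p Y ≫ F.map g
          invFun := fun h => F.preimage (ι Y ≫ h)
          left_inv := fun g => F.map_injective (by
            rw [F.map_preimage, ← Category.assoc, hp, Category.id_comp])
          right_inv := fun h => by
            simp only
            rw [F.map_preimage, hp₀] }
      homEquiv_naturality_left_symm := fun m h => F.map_injective (by
        simp only [Equiv.coe_fn_symm_mk, F.map_preimage, F.map_comp]
        rw [← Category.assoc, ← hι m, Category.assoc])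
      homEquiv_naturality_right := fun f k => by
        simp only [Equiv.coe_fn_mk, F.map_comp, Category.assoc] }⟩

/-- **Weight decomposition ⟹ the block inclusion preserves injective objects**, as soon as `R` preserves
monomorphisms (e.g. `R` a right adjoint — `π_*` is — or exact). [cite: Lieblich2007, arXiv Lemma 2.1.1.12
and Prop. 2.2.1.6] -/
theorem preservesInjectiveObjects_of_weightDecomposition [R.PreservesMonomorphisms] :
    F.PreservesInjectiveObjects := by
  obtain ⟨adj'⟩ := nonempty_adjunction_of_weightDecomposition ι p hι hp hp₀
  exact Functor.preservesInjectiveObjects_of_adjunction_of_preservesMonomorphisms adj'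

end WeightDecomposition

section WeightDecompositionExt

universe w w' w'' v v' v'' u u' u''

variable {C : Type u} [Category.{v} C] [Abelian C] {D : Type u'} [Category.{v'} D] [Abelian D]
  {D' : Type u''} [Category.{v''} D'] [Abelian D']
  {F : C ⥤ D} [F.Additive] [F.Full] [F.Faithful] [PreservesFiniteLimits F] [PreservesFiniteColimits F]
  {R : D ⥤ C} (adj : F ⊣ R) (p : ∀ Y : D, Y ⟶ F.obj (R.obj Y))
  (hp : ∀ Y : D, adj.counit.app Y ≫ p Y = 𝟙 (F.obj (R.obj Y)))
  (hp₀ : ∀ ⦃Y : D⦄ ⦃X : C⦄ (h : Y ⟶ F.obj X), p Y ≫ adj.counit.app Y ≫ h = h)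
  [HasExt.{w} C] [EnoughInjectives C]

include adj hp hp₀

/-- **`Ext`-comparison for the block inclusion, the left adjoint derived from the weight decomposition.**
`F : C ⥤ D` additive, exact, fully faithful with its STANDARD right adjoint `adj : F ⊣ R` (intended
`π^* ⊣ π_*`; so `R` preserves monomorphisms), `C` with enough injectives, and projections `p_Y : Y ⟶ F(R Y)`
splitting the counit (`ε_Y ≫ p_Y = 𝟙`: `F(R Y) = 𝓕₀` is a direct summand) through which every `h : Y ⟶ F X`
factors (`p_Y ≫ ε_Y ≫ h = h`: `Hom(𝓕₁, π^*E) = 0`) ⟹ `Extⁿ(X, Y) → Extⁿ(F X, F Y)` is bijective for all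
`X Y n`. This is the `π^*` half of R1.0 (i) with «`π_*π^* = id` on weight `0`» as its ONLY input beyond the
standard adjunction. [cite: Lieblich2007, arXiv Lemma 2.1.1.12 and Prop. 2.2.1.6; Hartshorne1977, III.2.2] -/
theorem mapExtAddHom_bijective_of_weightDecomposition [HasExt.{w'} D] (X Y : C) (n : ℕ) :
    Function.Bijective (F.mapExtAddHom X Y n) := by
  haveI : R.PreservesMonomorphisms := Functor.preservesMonomorphisms_of_adjunction adj
  haveI : F.PreservesInjectiveObjects :=
    preservesInjectiveObjects_of_weightDecomposition (fun Y => adj.counit.app Y) p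
      (fun _ _ m => adj.counit_naturality m) hp hp₀
  exact F.mapExt_bijective_of_preservesInjectiveObjects X Y n

/-- **The comparison `θ` of R1.0 (i) from the weight decomposition**: with `Φ : D ≌ D′` an (additive)
equivalence (intended `- ⊗ L^{∓1}`), `(F ⋙ Φ.functor).mapExtAddHom X Y n` — for sheaves `X = Y = E`, `n = 2`
the map of R1.0 shape `ξ ↦ π^*ξ ⊗ 1` on `Ext²` — is bijective. (Sheaf carriers; the route's two-term complex
`E₀` needs the derived analogue, not supplied here.)
[cite: Lieblich2007, arXiv Lemma 2.1.1.12 and Prop. 2.2.1.6; Hartshorne1977, III.2.2] -/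
theorem mapExtAddHom_comp_equivalence_bijective_of_weightDecomposition (Φ : D ≌ D')
    [Φ.functor.Additive] [HasExt.{w''} D'] (X Y : C) (n : ℕ) :
    Function.Bijective ((F ⋙ Φ.functor).mapExtAddHom X Y n) := by
  haveI : R.PreservesMonomorphisms := Functor.preservesMonomorphisms_of_adjunction adj
  obtain ⟨adj'⟩ := nonempty_adjunction_of_weightDecomposition (fun Y => adj.counit.app Y) p
    (fun _ _ m => adj.counit_naturality m) hp hp₀
  exact mapExtAddHom_comp_equivalence_bijective_of_leftAdjoint adj' Φ X Y n

/-- **Kernel clause of R1.0 from the weight decomposition** (carrier-free layer): component families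
`σ_q` on `Ext²_C(E, E)` and `σ′_q` on `Ext²_{D′}(Φ(F E), Φ(F E))` related triangularly through the real
`θ = (F ⋙ Φ.functor).mapExtAddHom E E 2` with diagonal injective on the LOWER set `I` and arbitrary mixing:
`(σ_q)_{q ∈ I}` jointly injective ⟺ `(σ′_q)_{q ∈ I}` jointly injective.
[cite: BuchweitzFlenner2003, §5 (I-semiregular); Lieblich2007, arXiv Prop. 2.2.1.6] -/
theorem jointlyInjective_iff_of_weightDecomposition_comp_equivalence (Φ : D ≌ D') [Φ.functor.Additive]
    [HasExt.{w''} D'] {W W' : ℕ → Type*} [∀ q, AddCommGroup (W q)] [∀ q, AddCommGroup (W' q)] {E : C}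
    {σ : ∀ q, Ext.{w} E E 2 →+ W q}
    {σ' : ∀ q, Ext.{w''} ((F ⋙ Φ.functor).obj E) ((F ⋙ Φ.functor).obj E) 2 →+ W' q}
    (d : ∀ q, W q →+ W' q) (u : ∀ q j, W j →+ W' q) {I : Set ℕ} (hI : IsLowerSet I)
    (hd : ∀ q ∈ I, Function.Injective (d q))
    (hσ : ∀ q ∈ I, ∀ x : Ext.{w} E E 2, σ' q ((F ⋙ Φ.functor).mapExtAddHom E E 2 x) =
      d q (σ q x) + ∑ j ∈ Finset.range q, u q j (σ j x)) :
    (∀ x : Ext.{w} E E 2, (∀ q ∈ I, σ q x = 0) → x = 0) ↔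
      ∀ x' : Ext.{w''} ((F ⋙ Φ.functor).obj E) ((F ⋙ Φ.functor).obj E) 2,
        (∀ q ∈ I, σ' q x' = 0) → x' = 0 := by
  haveI : R.PreservesMonomorphisms := Functor.preservesMonomorphisms_of_adjunction adj
  obtain ⟨adj'⟩ := nonempty_adjunction_of_weightDecomposition (fun Y => adj.counit.app Y) p
    (fun _ _ m => adj.counit_naturality m) hp hp₀
  exact jointlyInjective_iff_of_leftAdjoint_comp_equivalence adj' Φ d u hI hd hσ

end WeightDecompositionExt

end Summit.Ventures.HSemireg
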